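import Summits.AnomalousDissipation.AnomalousDissipation.Theorems.MomentParityResolvedDissipationSmallDataDirac
import Summits.AnomalousDissipation.AnomalousDissipation.Theorems.MomentParityResolvedDissipationSmallDataSteady

/-!
# `MomentParity.ResolvedDissipation` (stmt-AnomalousDissipation-14284), line `enstrophy-ui-transfer`:
# the hard stub holds in the laminar regime `‖f‖₂ ≤ ν²/4`

Supports stmt-AnomalousDissipation-14284 (helper of the line lead; nothing here closes an item).

`uniformIntegrability_smallForce`: the statement of the hard stub `stub_uniformIntegrability` of line
`enstrophy-ui-transfer` (N-uniform uniform integrability of the enstrophy over ALL admissible laws: probability,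
level-`N` carried, supported in a ball, stationary for Galerkin NS against all polynomial cylindrical band-limited
observables), PROVED for forces with `∫‖f‖² ≤ ν⁴/16`: by part III every level has a Galerkin steady state `s_N`
with `‖P_N s_N‖_∞ ≤ ν ≤ πν` and `‖∇s_N‖² ≤ ν²`, and by part II every admissible law (3-stationarity suffices) is the
Dirac mass at `s_N`; so no admissible law has enstrophy above `M = ν²`, uniformly in `N`. Fed into the reduction
`resolvedDissipation_of_uniformIntegrability` (`…Reduction.lean`) this gives the crux's conclusion for such forces
(`…SmallDataResolved.lean`). Outside the laminar regime the stub is the open content of the crux.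
-/

noncomputable section

-- `Summit.<Summit>.<Problem>`: single-conjunct summit, the duplicate namespace segment is mandated.
set_option linter.dupNamespace false

namespace Summit.AnomalousDissipation.AnomalousDissipation.Theorems.MomentParityResolvedDissipation

open MeasureTheory Filter Topology
open scoped ENNReal InnerProductSpace RealInnerProductSpace
open Literature.Analysis.FunctionSpaces Literature.Analysis.FluidPDE
open Summit.AnomalousDissipation.AnomalousDissipation.Theses.MomentParity
open Summit.AnomalousDissipation.AnomalousDissipation.Theorems.CubicParityLoud.Negative (T3 R3 H3 L2T3)
open Summit.AnomalousDissipation.AnomalousDissipation.Theorems.QuarticGate.Negative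
  (IsLevel IsBandTest polyGrad IsPolyStationary)

/-- **The hard stub of line `enstrophy-ui-transfer` in the laminar regime.** For every smooth force `f` and
`ν > 0` with `∫‖f‖² ≤ ν⁴/16`, every `R` and every `ε > 0` there is ONE level `M` (namely `M = ν²`) such that EVERY
probability law on `H` carried by level-`N` fields, supported in `‖u‖ ≤ R` and stationary for Galerkin NS at `(ν, f)`
at every polynomial order keeps at most `ε` (in fact `0`) of its mean enstrophy above `M`, for every `N`:
such laws are Dirac masses at the unique small Galerkin steady state (`ae_eq_of_galerkinSteady_of_sup_le`,
`exists_small_galerkinSteady`). [cite: Temam1979, Ch. II Thm. 1.3 (small-data uniqueness), ensemble form] -/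
theorem uniformIntegrability_smallForce :
    ∀ f : UnitAddTorus (Fin 3) → EuclideanSpace ℝ (Fin 3), Torus.IsSmooth f →
      ∀ ν : ℝ, 0 < ν → ∫ x, ‖f x‖ ^ 2 ≤ ν ^ 4 / 16 → ∀ R : ℝ, ∀ ε : ℝ≥0∞, 0 < ε → ∃ M : ℝ≥0∞, M ≠ ⊤ ∧
        ∀ (N : ℕ) (μ : Measure (Torus.energySpace (Fin 3))), IsProbabilityMeasure μ →
          (∀ᵐ u ∂μ, IsLevel N u) → (∀ᵐ u ∂μ, ‖u‖ ≤ R) → (∀ d : ℕ, IsPolyStationary ν f N d μ) →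
          ∫⁻ u in {u : Torus.energySpace (Fin 3) |
              M < Torus.eGradNormSq (u.1 : UnitAddTorus (Fin 3) → EuclideanSpace ℝ (Fin 3))},
            Torus.eGradNormSq (u.1 : UnitAddTorus (Fin 3) → EuclideanSpace ℝ (Fin 3)) ∂μ ≤ ε := by
  intro f hf ν hν hsmall R ε _hε
  refine ⟨ENNReal.ofReal (ν ^ 2), ENNReal.ofReal_ne_top, fun N μ _ hL _ hS => ?_⟩
  obtain ⟨s, hs, hst, hsup, hZ⟩ := exists_small_galerkinSteady hν hf hsmall N
  have hπν : ν ≤ Real.pi * ν := by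
    have : (1 : ℝ) ≤ Real.pi := by linarith [Real.pi_gt_three]
    nlinarith
  rw [setLIntegral_eGradNormSq_eq_zero_of_galerkinSteady hν hf hL (hS 3) hs hst hsup hπν hZ]
  exact zero_le

end Summit.AnomalousDissipation.AnomalousDissipation.Theorems.MomentParityResolvedDissipation

end
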